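import Mathlib
import Summits.Ventures.PercRepro2.FourTypedEdges
import Summits.Ventures.PercRepro2.SortedPairs5Code

/-!
# Five typed edges: the bridge lemmas (blind cell PercRepro2, night-3, 2026-08-24)

An inert typed edge of a set of at most five reduces to the four-edge theorem (`nonneg_of_inert5`,
modulo `allOk4 = true`); a typed edge whose ends are joined in the closed configuration is inert
(`nonneg_of_loop5`); the ends of the five typed edges are taken from a list of pairs `ps : Fin 5 → V × V`
(`xsOf5 ps`, the sorted representative of `SortedPairs5`).
-/

namespace Summit.Ventures.PercRepro2

open UnionCluster

namespace CovForm

namespace TwoTyped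

open OneTyped TypedRed

section Bridge5

open Classical

variable {V : Type*} {E : Type*} [Fintype E] [DecidableEq E] {R : Type*} [Field R]
  [LinearOrder R] [IsStrictOrderedRing R]
variable (ends : E → Sym2 V) (o a₁ a₂ a₃ b : V)

/-- An inert typed edge of a set of at most five typed edges: the count is nonnegative by the
four-edge theorem (modulo `allOk4 = true`). -/
lemma nonneg_of_inert5 (hall4 : allOk4 = true) (F : Finset E) (e : E) (he : e ∈ F) (hF : F.card ≤ 5)
    {z : Config E} {τ : E → ℕ} (hτ : ∀ e' ∈ F, τ e' = 1 ∨ τ e' = 2)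
    (h : typedCount F z τ (K3 ends o a₁ a₂ a₃ b : Config E → Config E → Config E → R) =
      (Nat.choose 3 (τ e) : R) * typedCount F z (Function.update τ e 0) (K3 ends o a₁ a₂ a₃ b)) :
    0 ≤ typedCount F z τ (K3 ends o a₁ a₂ a₃ b : Config E → Config E → Config E → R) := by
  rw [h, typedCount_type_zero F e he z _ (by simp)]
  refine mul_nonneg (Nat.cast_nonneg _) ?_
  refine typedCount_nonneg_of_card_le_four ends o a₁ a₂ a₃ b hall4 (F.erase e) ?_ _ _ ?_
  · rw [Finset.card_erase_of_mem he]; omega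
  · intro e' he'
    rw [Function.update_of_ne (Finset.ne_of_mem_erase he')]
    exact hτ e' (Finset.mem_of_mem_erase he')

/-- **A typed edge with joined ends** (five typed edges): the count is nonnegative. -/
lemma nonneg_of_loop5 (hall4 : allOk4 = true) (e₁ e₂ e₃ e₄ e₅ : E) (z : Config E) (τ : E → ℕ)
    (hτ : ∀ e ∈ ({e₁, e₂, e₃, e₄, e₅} : Finset E), τ e = 1 ∨ τ e = 2) (z0 : Config E)
    (hz0c : closedOn ({e₁, e₂, e₃, e₄, e₅} : Finset E) z = z0) (ps : Fin 5 → V × V)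
    (hends₁ : ends e₁ = s((ps 0).1, (ps 0).2))
    (hends₂ : ends e₂ = s((ps 1).1, (ps 1).2))
    (hends₃ : ends e₃ = s((ps 2).1, (ps 2).2))
    (hends₄ : ends e₄ = s((ps 3).1, (ps 3).2))
    (hends₅ : ends e₅ = s((ps 4).1, (ps 4).2))
    (hl : lab ends o a₁ a₂ a₃ b (xsOf5 ps) z0 5 = lab ends o a₁ a₂ a₃ b (xsOf5 ps) z0 6 ∨
      lab ends o a₁ a₂ a₃ b (xsOf5 ps) z0 7 = lab ends o a₁ a₂ a₃ b (xsOf5 ps) z0 8 ∨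
      lab ends o a₁ a₂ a₃ b (xsOf5 ps) z0 9 = lab ends o a₁ a₂ a₃ b (xsOf5 ps) z0 10 ∨
      lab ends o a₁ a₂ a₃ b (xsOf5 ps) z0 11 = lab ends o a₁ a₂ a₃ b (xsOf5 ps) z0 12 ∨
      lab ends o a₁ a₂ a₃ b (xsOf5 ps) z0 13 = lab ends o a₁ a₂ a₃ b (xsOf5 ps) z0 14) :
    0 ≤ typedCount {e₁, e₂, e₃, e₄, e₅} z τ (K3 ends o a₁ a₂ a₃ b : Config E → Config E → Config E → R) := by
  rcases hl with hl | hl | hl | hl | hl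
  · refine nonneg_of_inert5 ends o a₁ a₂ a₃ b hall4 {e₁, e₂, e₃, e₄, e₅} e₁ (by simp) (Finset.card_le_five) hτ ?_
    refine typedCount_inert_of_conn ends o a₁ a₂ a₃ b {e₁, e₂, e₃, e₄, e₅} e₁ (by simp) hends₁ z τ ?_
    rw [hz0c]
    exact (lab_eq_iff ends o a₁ a₂ a₃ b (xsOf5 ps) z0 5 6).mp hl
  · refine nonneg_of_inert5 ends o a₁ a₂ a₃ b hall4 {e₁, e₂, e₃, e₄, e₅} e₂ (by simp) (Finset.card_le_five) hτ ?_
    refine typedCount_inert_of_conn ends o a₁ a₂ a₃ b {e₁, e₂, e₃, e₄, e₅} e₂ (by simp) hends₂ z τ ?_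
    rw [hz0c]
    exact (lab_eq_iff ends o a₁ a₂ a₃ b (xsOf5 ps) z0 7 8).mp hl
  · refine nonneg_of_inert5 ends o a₁ a₂ a₃ b hall4 {e₁, e₂, e₃, e₄, e₅} e₃ (by simp) (Finset.card_le_five) hτ ?_
    refine typedCount_inert_of_conn ends o a₁ a₂ a₃ b {e₁, e₂, e₃, e₄, e₅} e₃ (by simp) hends₃ z τ ?_
    rw [hz0c]
    exact (lab_eq_iff ends o a₁ a₂ a₃ b (xsOf5 ps) z0 9 10).mp hl
  · refine nonneg_of_inert5 ends o a₁ a₂ a₃ b hall4 {e₁, e₂, e₃, e₄, e₅} e₄ (by simp) (Finset.card_le_five) hτ ?_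
    refine typedCount_inert_of_conn ends o a₁ a₂ a₃ b {e₁, e₂, e₃, e₄, e₅} e₄ (by simp) hends₄ z τ ?_
    rw [hz0c]
    exact (lab_eq_iff ends o a₁ a₂ a₃ b (xsOf5 ps) z0 11 12).mp hl
  · refine nonneg_of_inert5 ends o a₁ a₂ a₃ b hall4 {e₁, e₂, e₃, e₄, e₅} e₅ (by simp) (Finset.card_le_five) hτ ?_
    refine typedCount_inert_of_conn ends o a₁ a₂ a₃ b {e₁, e₂, e₃, e₄, e₅} e₅ (by simp) hends₅ z τ ?_
    rw [hz0c]
    exact (lab_eq_iff ends o a₁ a₂ a₃ b (xsOf5 ps) z0 13 14).mp hl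

end Bridge5

end TwoTyped

end CovForm

end Summit.Ventures.PercRepro2
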